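import Literature.GroupTheory.FiniteAbelian.InvariantFactorsUnique
import HarnessLib

/-!
# Uniqueness of the type of a «squared» invariant-factor group `(Πᵢ ℤ/δᵢ) × (Πᵢ ℤ/δᵢ)`

Family `hodge`, layer `Literature/GroupTheory/FiniteAbelian`; cell hodgecm-mathlib (U-DAG brick B4, flag (d):
the TYPE `δ` of a polarisation — [MumfordFogartyKirwan1994] App. 7A «`ker(λ) ≅ ∏ ℤ/δᵢℤ × ∏ μ_{δᵢ}`»,
[LangeBirkenhake1992] §3.1 — is read off the kernel of `λ` on geometric points as the group
`(Πᵢ ℤ/δᵢ)²` with `δ₁ ∣ δ₂ ∣ ⋯ ∣ δ_g`, all `δᵢ ≥ 1`; this file proves that such a group determines `δ`).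

THE STATEMENT ([Hungerford1974] Ch. II Thm. 2.6 (ii), uniqueness of invariant factors, in the squared shape with
entries `= 1` allowed and the length `g` fixed): if `(Πᵢ ℤ/δᵢ) × (Πᵢ ℤ/δᵢ) ≃+ (Πᵢ ℤ/δ'ᵢ) × (Πᵢ ℤ/δ'ᵢ)` for two
divisibility chains `δ, δ' : Fin g → ℕ` of positive integers, then `δ = δ'`.  Proof = the counting proof of the
tree's ★ `InvariantFactorsUnique` ([Hungerford1974] Lemma 2.5 (v)–(vi), [AdkinsWeintraub1992] Ch. 3 Thm. (7.3)):
`|G[n]| = (∏ᵢ gcd(n, δᵢ))²` for every `n ≥ 1`, squares of naturals are injective, and ★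
`chain_eq_of_forall_prod_gcd_eq` (two chains of the same length with the same counts coincide).  The
`Multiplicative` spelling (`…_of_mulEquiv`) is the one the tree's `Polarization.HasType` speaks.
No definition, no named fact, no `sorry`.

## References
* [Hungerford1974] T. W. Hungerford, *Algebra*, GTM 73 (1974), Ch. II §2 Lemma 2.5 and Thm. 2.6 (ii) (PDF p. 137).
* [AdkinsWeintraub1992] W. A. Adkins, S. H. Weintraub, *Algebra*, GTM 136 (1992), Ch. 3 §7 Thm. (7.3).
* [MumfordFogartyKirwan1994] D. Mumford, J. Fogarty, F. Kirwan, *Geometric Invariant Theory*, 3rd ed. (1994), App. 7A (pp. 234–235).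
* [LangeBirkenhake1992] H. Lange, Ch. Birkenhake, *Complex Abelian Varieties* (1992), §3.1 (type of a polarisation).
-/

namespace Literature.GroupTheory.FiniteAbelian

open Finset

variable {g : ℕ}

/-- **`|((Πᵢ ℤ/δᵢ) × (Πᵢ ℤ/δᵢ))[n]| = (∏ᵢ gcd(n, δᵢ))²`** for `n ≥ 1`, `δᵢ ≥ 1`.
[cite: Hungerford1974, Ch. II Lemma 2.5 (v)–(vi) (PDF p. 137)] -/
theorem natCard_nsmul_eq_zero_pi_zmod_sq (δ : Fin g → ℕ) (hδ : ∀ i, 0 < δ i) {n : ℕ} (hn : 0 < n) :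
    Nat.card {x : ((Π i, ZMod (δ i)) × (Π i, ZMod (δ i))) // n • x = 0} = (∏ i, Nat.gcd n (δ i)) ^ 2 := by
  have h1 : Nat.card {x : (Π i, ZMod (δ i)) // n • x = 0} = ∏ i, Nat.gcd n (δ i) := by
    have h := natCard_nsmul_eq_zero_prod_pi_zmod 0 δ hδ hn
    rw [natCard_nsmul_eq_zero_prod, natCard_nsmul_eq_zero_pi (fun _ : Fin 0 ↦ ℤ)] at h
    simpa using h
  rw [natCard_nsmul_eq_zero_prod, h1, sq]

/-- **Uniqueness of the type of `(Πᵢ ℤ/δᵢ)²`**: two divisibility chains `δ, δ'` of positive integers of the same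
length whose squared groups are isomorphic coincide ([Hungerford1974] Thm. 2.6 (ii), squared shape; entries `1`
allowed since the length is fixed). [cite: Hungerford1974, Ch. II Thm. 2.6 (ii) (PDF p. 137)]
[cite: AdkinsWeintraub1992, Ch. 3 §7 Thm. (7.3)] -/
theorem pi_zmod_sq_chain_unique {δ δ' : Fin g → ℕ} (hδ : ∀ i, 0 < δ i) (hδ' : ∀ i, 0 < δ' i)
    (hc : ∀ i j, i ≤ j → δ i ∣ δ j) (hc' : ∀ i j, i ≤ j → δ' i ∣ δ' j)
    (e : ((Π i, ZMod (δ i)) × (Π i, ZMod (δ i))) ≃+ ((Π i, ZMod (δ' i)) × (Π i, ZMod (δ' i)))) :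
    δ = δ' := by
  refine chain_eq_of_forall_prod_gcd_eq hδ hδ' hc hc' fun n hn ↦ ?_
  have h := natCard_nsmul_eq_zero_congr e n
  rw [natCard_nsmul_eq_zero_pi_zmod_sq δ hδ hn, natCard_nsmul_eq_zero_pi_zmod_sq δ' hδ' hn] at h
  exact Nat.pow_left_injective two_ne_zero h

/-- The same uniqueness in the `Multiplicative` spelling of ★ `AbelianSchemeOver.Polarization.HasType`
(«`ker(λ)(Ω) ≅ (∏ᵢ ℤ/δᵢ)²`» written multiplicatively). [cite: Hungerford1974, Ch. II Thm. 2.6 (ii) (PDF p. 137)]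
[cite: MumfordFogartyKirwan1994, App. 7A (pp. 234–235)] -/
theorem pi_zmod_sq_chain_unique_of_mulEquiv {δ δ' : Fin g → ℕ} (hδ : ∀ i, 0 < δ i) (hδ' : ∀ i, 0 < δ' i)
    (hc : ∀ i j, i ≤ j → δ i ∣ δ j) (hc' : ∀ i j, i ≤ j → δ' i ∣ δ' j)
    (e : Multiplicative ((Π i, ZMod (δ i)) × (Π i, ZMod (δ i))) ≃*
      Multiplicative ((Π i, ZMod (δ' i)) × (Π i, ZMod (δ' i)))) :
    δ = δ' :=
  pi_zmod_sq_chain_unique hδ hδ' hc hc' (MulEquiv.toAdditive e)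

/-- **Two injective homomorphisms `(Πᵢ ℤ/δᵢ)² ↪ P`, `(Πᵢ ℤ/δ'ᵢ)² ↪ P` with the SAME image force `δ = δ'`** —
the shape in which ★ `Polarization.HasType δ` and `HasType δ'` meet at one geometric point (both images are the
kernel of `λ̄` on `Ω`-points). [cite: Hungerford1974, Ch. II Thm. 2.6 (ii) (PDF p. 137)]
[cite: MumfordFogartyKirwan1994, App. 7A (pp. 234–235)] -/
theorem pi_zmod_sq_chain_unique_of_range_eq {P : Type*} [CommGroup P] {δ δ' : Fin g → ℕ}
    (hδ : ∀ i, 0 < δ i) (hδ' : ∀ i, 0 < δ' i) (hc : ∀ i j, i ≤ j → δ i ∣ δ j) (hc' : ∀ i j, i ≤ j → δ' i ∣ δ' j)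
    {φ : Multiplicative ((Π i, ZMod (δ i)) × (Π i, ZMod (δ i))) →* P}
    {φ' : Multiplicative ((Π i, ZMod (δ' i)) × (Π i, ZMod (δ' i))) →* P}
    (hφ : Function.Injective φ) (hφ' : Function.Injective φ') (h : Set.range φ = Set.range φ') :
    δ = δ' := by
  have hr : φ.range = φ'.range := SetLike.coe_injective (by simpa [MonoidHom.coe_range] using h)
  exact pi_zmod_sq_chain_unique_of_mulEquiv hδ hδ' hc hc'
    ((MonoidHom.ofInjective hφ).trans ((MulEquiv.subgroupCongr hr).trans (MonoidHom.ofInjective hφ').symm))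

end Literature.GroupTheory.FiniteAbelian
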